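import Summits.HodgeConjecture.HodgeConjecture.Theorems.K2LiuLineThetaKernelMirror
import Summits.HodgeConjecture.HodgeConjecture.Theorems.K2LiuConjugateSymplecticInv
import HarnessLib

/-!
# `conj θ_{Φ,λ,⟨a⟩} = θ_{Φ̄,λ⁻¹,⟨−a⟩}` — organ (O44c) layer (c1) at `λ₂ := λ⁻¹`, package (B)'s token form

Track B ∕ hLiu418 = stmt-HodgeConjecture-24832, line `K2_Liu_CurveThetaSigs`, unit U6 ED. 5 (package (B), «M-154t»: hypothesis-side kernels of #42R ∕ #44∕45R at
`lam⁻¹`, conclusion kernels at `lam`); seat `hodgecm-mathlib-K2Liu-p03` (g2).  The instance `λ₂ := λ⁻¹` of ★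
`K2LiuLineThetaKernelMirror.conj_lineThetaKer_mk_eq_neg` (which takes any `λ₂` with `toHeckeCharacter λ₂ = (toHeckeCharacter λ)⁻¹`), discharging its two
side inputs by ★ `K2LiuConjugateSymplecticInv.IsConjugateSymplectic.inv` (p01: `λ⁻¹` is conjugate symplectic) and `toHeckeCharacter λ⁻¹ = (toHeckeCharacter λ)⁻¹` (pointwise, `toHeckeCharacter_inv'`):

* `conj_lineThetaKer_mk_eq_inv_neg` — `conj ((lineThetaKernelDatum … lam hlam a hρ).thetaKer Φ (mk x, mk q)) =
  (lineThetaKernelDatum … lam⁻¹ (IsConjugateSymplectic.inv hlam) (−a) hρ₂).thetaKer (C Φ) (mk x, mk q₂)` for `q₂, q` with the same matrix; rank `N` generic.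
* `lineThetaKer_inv_neg_mk_eq_conj` — the same read from the `lam⁻¹` side (the hypothesis side of package (B)): `θ_{Ψ,λ⁻¹,⟨−a⟩}(x, q₂) =
  conj θ_{C Ψ,λ,⟨a⟩}(x, q)`.

No definition, no instance, no named fact; axioms ⊆ {propext, Classical.choice, Quot.sound}.

## References
* Y. Liu, *Fourier–Jacobi cycles and arithmetic relative trace formula*, Camb. J. Math. 9 (2021), App. D Lemma D.1 (2), Remark 4.4 [Liu2021].
* S. Kudla, Israel J. Math. 87 (1994), §3 Thm. 3.1 [Kudla1994].  J.-S. Li, J. reine angew. Math. 428 (1992), p. 181 [Li1992].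

HONEST LABEL: HC_CM is proved only modulo the 7 printed citations (2 remaining named inputs: hLiu418 =
stmt-HodgeConjecture-24832, h413 = stmt-HodgeConjecture-24833) until rung 0 closes; this helper moves no counter.
-/

noncomputable section

set_option autoImplicit false

set_option linter.dupNamespace false

open scoped Classical
open scoped Matrix ComplexConjugate
open NumberField IsDedekindDomain

namespace Summit.HodgeConjecture.HodgeConjecture.Cruxes.HLiu418.K2LiuLineThetaKernelMirror

open Literature.RepresentationTheory.HeisenbergGroup
open Literature.NumberTheory.Automorphic Literature.NumberTheory.Automorphic.UnitaryGroup
open Literature.NumberTheory.Automorphic.IdeleClassGroup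
open Literature.NumberTheory.Weil1964
open Literature.NumberTheory.GaloisRepresentations
open Literature.NumberTheory.GelbartRogawski1991 Literature.NumberTheory.GelbartRogawski1991.UnitaryDualPair
open Literature.NumberTheory.GelbartRogawski1991.GRConstruction
open Literature.NumberTheory.Automorphic.Liu2021 Literature.NumberTheory.Automorphic.Liu2021.Def411WeilCarriers
open Literature.NumberTheory.Automorphic.Liu2021.Def411WeilCarriersDoubling
open Literature.RepresentationTheory.Liu2021
open Summit.HodgeConjecture.HodgeConjecture.Cruxes.HLiu418.K2LiuConjugateSymplecticInv (IsConjugateSymplectic.inv)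

/-- `toHeckeCharacter` of an inverse is the inverse Hecke character (pointwise; the same statement as ★
`Liu2021.LemD1AsPrintedIndexedNonVacuityTameTwistCM.toHeckeCharacter_inv`, restated here to keep this file's import closure light).
[cite: Liu2021, Def. 4.1] -/
theorem toHeckeCharacter_inv' (L : Type) [Field L] [NumberField L] (ψ : Literature.NumberTheory.Automorphic.IdeleClassGroup L →ₜ* Circle) :
    toHeckeCharacter L ψ⁻¹ = (toHeckeCharacter L ψ)⁻¹ :=
  HeckeCharacter.ext fun x => Units.ext (by
    rw [coe_toHeckeCharacter_apply, HeckeCharacter.inv_apply, Units.val_inv_eq_inv_val, coe_toHeckeCharacter_apply,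
      show ψ⁻¹ x = (ψ x)⁻¹ from rfl, Circle.coe_inv])

variable (L : Type) [Field L] [NumberField L] [IsCMField L] (N : ℕ) {n' : ℕ} (e₁ : Fin N × Fin 1 ≃ Fin n')
  (dV : Fin N → L) (hdV : ∀ i, IsCMField.complexConj L (dV i) = dV i) (hdV0 : ∀ i, dV i ≠ 0)
  (lam : Literature.NumberTheory.Automorphic.IdeleClassGroup L →ₜ* Circle) (hlam : IsConjugateSymplectic L lam) (a : (Fp L)ˣ)
  (hρ : HasThetaMajorants fun
    (p : ↥(UnitaryGroup.adelic (Fp L) L (IsCMField.complexConj L) N (Matrix.diagonal dV)) ×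
      ↥(UnitaryGroup.adelic (Fp L) L (IsCMField.complexConj L) 1 (JW (Fp L) L a)))
    (Φ : piSchwartzBruhat (Fp L) (Fin n')) =>
      pairRep (Fp L) L (IsCMField.complexConj L) N 1 e₁ (Matrix.diagonal dV) (JW (Fp L) L a)
        (chiSplittingLine L e₁ dV hdV hdV0 (toHeckeCharacter L lam) (isUnitary_toHeckeCharacter L lam)
          ((isOscillatorChar_toHeckeCharacter_iff lam).mpr hlam) (TW (Fp L) a) (isUnit_det_TW (Fp L) a) (JW (Fp L) L a) (JW_eq (Fp L) L a))
        p Φ)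
  (hρ₂ : HasThetaMajorants fun
    (p : ↥(UnitaryGroup.adelic (Fp L) L (IsCMField.complexConj L) N (Matrix.diagonal dV)) ×
      ↥(UnitaryGroup.adelic (Fp L) L (IsCMField.complexConj L) 1 (JW (Fp L) L (-a))))
    (Φ : piSchwartzBruhat (Fp L) (Fin n')) =>
      pairRep (Fp L) L (IsCMField.complexConj L) N 1 e₁ (Matrix.diagonal dV) (JW (Fp L) L (-a))
        (chiSplittingLine L e₁ dV hdV hdV0 (toHeckeCharacter L lam⁻¹) (isUnitary_toHeckeCharacter L lam⁻¹)
          ((isOscillatorChar_toHeckeCharacter_iff lam⁻¹).mpr (IsConjugateSymplectic.inv hlam)) (TW (Fp L) (-a)) (isUnit_det_TW (Fp L) (-a)) (JW (Fp L) L (-a))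
          (JW_eq (Fp L) L (-a)))
        p Φ)
  (x : ↥(UnitaryGroup.adelic (Fp L) L (IsCMField.complexConj L) N (Matrix.diagonal dV)))
  (q : ↥(UnitaryGroup.adelic (Fp L) L (IsCMField.complexConj L) 1 (JW (Fp L) L a)))
  (q₂ : ↥(UnitaryGroup.adelic (Fp L) L (IsCMField.complexConj L) 1 (JW (Fp L) L (-a))))
  (hq : (q₂ : GL (Fin 1) (AdeleRing (𝓞 L) L)) = (q : GL (Fin 1) (AdeleRing (𝓞 L) L)))

include hq in
/-- **`conj θ_{Φ,λ,⟨a⟩}(x, q) = θ_{Φ̄,λ⁻¹,⟨−a⟩}(x, q₂)`** (★ `conj_lineThetaKer_mk_eq_neg` at `λ₂ := λ⁻¹`; `λ⁻¹` conjugate symplectic by ★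
`IsConjugateSymplectic.inv`, `toHeckeCharacter λ⁻¹ = (toHeckeCharacter λ)⁻¹` by `toHeckeCharacter_inv'`). [cite: Liu2021, App. D Lemma D.1 (2); Remark 4.4]
[cite: Kudla1994, §3 Thm. 3.1] -/
theorem conj_lineThetaKer_mk_eq_inv_neg (Φ : piSchwartzBruhat (Fp L) (Fin n')) :
    conj ((lineThetaKernelDatum L N e₁ dV hdV hdV0 lam hlam a hρ).thetaKer Φ (QuotientGroup.mk x, QuotientGroup.mk q)) =
      (lineThetaKernelDatum L N e₁ dV hdV hdV0 lam⁻¹ (IsConjugateSymplectic.inv hlam) (-a) hρ₂).thetaKer (piSchwartzBruhatConj (Fp L) (Fin n') Φ)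
        (QuotientGroup.mk x, QuotientGroup.mk q₂) :=
  conj_lineThetaKer_mk_eq_neg L N e₁ dV hdV hdV0 lam lam⁻¹ hlam (IsConjugateSymplectic.inv hlam) (toHeckeCharacter_inv' L lam) a hρ hρ₂ Φ x q q₂ hq

include hq in
/-- **The hypothesis side of package (B) read as a conjugate**: `θ_{Ψ,λ⁻¹,⟨−a⟩}(x, q₂) = conj θ_{C Ψ,λ,⟨a⟩}(x, q)` (previous theorem at `Φ := C Ψ`, `C C Ψ = Ψ`).
[cite: Liu2021, App. D Lemma D.1 (2); Remark 4.4] [cite: Li1992, p. 181] -/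
theorem lineThetaKer_inv_neg_mk_eq_conj (Ψ : piSchwartzBruhat (Fp L) (Fin n')) :
    (lineThetaKernelDatum L N e₁ dV hdV hdV0 lam⁻¹ (IsConjugateSymplectic.inv hlam) (-a) hρ₂).thetaKer Ψ (QuotientGroup.mk x, QuotientGroup.mk q₂) =
      conj ((lineThetaKernelDatum L N e₁ dV hdV hdV0 lam hlam a hρ).thetaKer (piSchwartzBruhatConj (Fp L) (Fin n') Ψ)
        (QuotientGroup.mk x, QuotientGroup.mk q)) := by
  have h := conj_lineThetaKer_mk_eq_inv_neg L N e₁ dV hdV hdV0 lam hlam a hρ hρ₂ x q q₂ hq (piSchwartzBruhatConj (Fp L) (Fin n') Ψ)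
  rw [piSchwartzBruhatConj_piSchwartzBruhatConj] at h
  exact h.symm

end Summit.HodgeConjecture.HodgeConjecture.Cruxes.HLiu418.K2LiuLineThetaKernelMirror

end
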